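import Literature.Computability.Complexity.MoebiusBoundedDepthProofs
import Literature.NumberTheory.LFunctions.MoebiusWalshCircuitsACdProofs
import Literature.NumberTheory.LFunctions.MoebiusWalshCircuitsFourierWalshProofs
import HarnessLib

/-!
# Green 2012, Proposition 1 and Theorem 1 for the Liouville function
# (`Green2012_liouville_walshCoeff`, `Green2012_liouville_boundedDepth`), discharged

Topic `Literature/Computability/Complexity`; proofs-only sibling of `MoebiusBoundedDepth.lean`
(the named facts `Literature.Computability.Complexity.Green2012_liouville_walshCoeff` and
`Literature.Computability.Complexity.Green2012_liouville_boundedDepth`). Everything here is PROVED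
(two theorems; no definition, no named fact).

B. Green, *On (not) computing the Möbius function using bounded depth circuits*, Combin. Probab.
Comput. **21** (2012) 942–951 (= arXiv:1103.4991) [Green2012]:

* **Proposition 1** (p. 943; arXiv p. 2): "Suppose that `S ⊆ {1,…,n}` is a set of size `k`. Then
  we have `μ̂(S) = O(k e^{-c n^{1/2}/k})`", where for `N = 2ⁿ` and `x = Σ_{i∈[n]} x_i 2^i`,
  `μ̂(S) = 𝔼_{0 ≤ x < N} μ(x) ∏_{i∈S} (-1)^{x_i}` is the Fourier–Walsh coefficient;
* **Theorem 1** (p. 942; arXiv p. 1): "Suppose `N = 2ⁿ`. Let `F : {0,…,N-1} → {-1,1}` be an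
  `AC⁰(d)` function. Then `𝔼_{0 ≤ x ≤ N-1} μ(x)F(x) = O(e^{d log n - c n^{1/6d}})`, where `c > 0` is
  an absolute constant";
* §1, p. 943: "All of the results in this paper hold equally well for the Liouville function,
  with very similar proofs."

Both statements for `λ` are PROVED in the tree in the `LFunctions` vocabulary (`walshSum`,
`circuitCorrelation` of `Literature/NumberTheory/LFunctions/MoebiusWalshCircuits.lean`), following
the printed proof:

* §§3–4 (Proposition 1 for `λ`: Kátai's Proposition 2, the minor-arc Proposition 4 through
  `λ = 𝟙_□ ⋆ μ`, the Harman–Kátai Lemma 1, and Corollary 2 of Theorem 3 on `2`-power moduli) is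
  `Literature.NumberTheory.LFunctions.green_liouville_fourierWalsh_holds`
  (`LFunctions/MoebiusWalshCircuitsFourierWalshProofs.lean`), the discharge of the named fact
  `Literature.NumberTheory.LFunctions.green_liouville_fourierWalsh`;
* §2 (Theorem 1 from Proposition 1: Parseval on the cube, the trivial bound on the low Walsh
  levels, Cauchy–Schwarz and the Linial–Mansour–Nisan Fourier tails) is
  `Literature.NumberTheory.LFunctions.green_liouville_ACd_of_fourierWalsh`
  (`LFunctions/MoebiusWalshCircuitsACdProofs.lean`; the composition is also recorded as
  `Literature.NumberTheory.LFunctions.green_liouville_ACd_holds`, `LFunctions/GreenLiouvilleACdHolds.lean`);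
* the proved dedup bridges `Green2012_liouville_walshCoeff_iff` and
  `Green2012_liouville_boundedDepth_iff` (`MoebiusBoundedDepthProofs.lean`) identify this topic's
  renderings (cube sums of `λ(val x) · ∏_{i∈S} (x_i ? -1 : 1)`, resp. `λ(val x) · sgn (K.eval x)`,
  all `n`, `sgn true = -1`) with those `LFunctions` facts (`n ≥ 1`).

This file only transports the two proved `LFunctions` statements along the bridges; the Möbius
twins are `Green2012_moebius_walshCoeff_holds` (`MoebiusBoundedDepthWalshProofs.lean`) and
`Green2012_moebius_boundedDepth_holds` (`MoebiusBoundedDepthHolds.lean`).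

## References

* B. Green, Combin. Probab. Comput. 21 (2012) 942–951, Proposition 1, Theorem 1, §1 (remark on
  `λ`); §2 (deduction of Theorem 1 from Proposition 1); §§3–4 (Proposition 1). [Green2012]
-/

namespace Literature.Computability.Complexity

/-- **Green 2012, Proposition 1 for the Liouville function — discharged.** The named fact
`Green2012_liouville_walshCoeff` holds: there are absolute `c > 0`, `C` such that for all `n`,
all nonempty `S ⊆ Fin n`,
`|(∑_{x ∈ {0,1}ⁿ} λ(val x) ∏_{i∈S} (x_i ? -1 : 1)) / 2ⁿ| ≤ C · |S| · exp (-c √n / |S|)`.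
Proof: Green's Proposition 1 for `λ` as proved in the tree
(`Literature.NumberTheory.LFunctions.green_liouville_fourierWalsh_holds`, §§3–4 of the paper),
transported along the bridge `Green2012_liouville_walshCoeff_iff`.
[cite: Green2012, Proposition 1 and §1 (remark on λ)] -/
theorem Green2012_liouville_walshCoeff_holds : Green2012_liouville_walshCoeff :=
  Green2012_liouville_walshCoeff_iff.2
    Literature.NumberTheory.LFunctions.green_liouville_fourierWalsh_holds

/-- **Green 2012, Theorem 1 for the Liouville function — discharged.** The named fact
`Green2012_liouville_boundedDepth` holds: there are absolute `c > 0`, `C` such that for every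
`d ≥ 1`, every `n` and every circuit `K` over `acBasis` on `Fin n` with `K.depth ≤ d` and
`K.size ≤ n ^ d`, `|(∑ₓ λ(val x) · sgn (K.eval x)) / 2ⁿ| ≤ C · exp (d log n − c n^{1/(6d)})`.
Proof as printed: Theorem 1 from Proposition 1 (§2, `green_liouville_ACd_of_fourierWalsh`) applied
to the proved Proposition 1 for `λ` (`green_liouville_fourierWalsh_holds`; this composition is
also the tree's `Literature.NumberTheory.LFunctions.green_liouville_ACd_holds`), transported along
the bridge
`Green2012_liouville_boundedDepth_iff`. [cite: Green2012, Theorem 1 and §1 (remark on λ)] -/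
theorem Green2012_liouville_boundedDepth_holds : Green2012_liouville_boundedDepth :=
  Green2012_liouville_boundedDepth_iff.2
    (Literature.NumberTheory.LFunctions.green_liouville_ACd_of_fourierWalsh
      Literature.NumberTheory.LFunctions.green_liouville_fourierWalsh_holds)

end Literature.Computability.Complexity
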